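/-
Copyright: internal research formalization. Sources: G. Blekherman, P. A. Parrilo, R. R. Thomas
(eds.), *Semidefinite Optimization and Convex Algebraic Geometry*, MOS–SIAM Ser. Optim. 13 (2012),
Ch. 3 (Parrilo), Exercise 3.140 (2), p. 121 [BlekhermanParriloThomas2012] ("the optimal solution
that minimizes `γ` is `γ*_N = 1/((2N+2)² − 1)`", case `N = 0`); G. Stengle, "Complexity estimates
for the Schmüdgen Positivstellensatz", J. Complexity 12 (1996) 167–174 [Stengle1996], relation (1)
and the degree-0 example `5/3 − x²` (p. 169).
-/
import Mathlib
import Literature.Algebra.Polynomial.StengleDegreeUpperBound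
import HarnessLib

/-!
# Stengle's relation (1): the first rung is exactly optimal (`N(δ) = 0 ⟺ δ ≥ 1/3`)

For Stengle's relation `(1)  1 − x² + δ = P (1 − x²)³ + Q`, `P, Q ≥ 0` on `ℝ`,
[BlekhermanParriloThomas2012, Ch. 3 Exercise 3.140 (2)] asserts that `γ*_N = 1/((2N+2)² − 1)` is
the OPTIMAL (least) `γ` admitting a representation with multiplier degree `4N`.  The existence side
for every degree is `StengleDegreeUpperBound.stengle_chebyshev_certificate`; the general lower side
in the tree is Stengle's Theorem 4 with the non-sharp constant `1/11`
(`StengleDegreeLowerBound.stengle_theorem4`).  This file types the EXACT optimality of the first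
rung `N = 0` (`γ*_0 = 1/3`): a representation (1) with a CONSTANT multiplier `P = p` exists iff
`δ ≥ 1/3`.  Proof of necessity (two evaluations of (1)): at `x = 0`, `p ≤ 1 + δ`; at `x² = 3/2`
(where `(1 − x²)³ = −1/8`), `δ − 1/2 ≥ −p/8`; together `9δ ≥ 3`.  The point `x² = 3/2` is the
double root of `Q = x²(3 − 2x²)²/3` in the optimal certificate `4/3 − x² = (4/3)(1 − x²)³ + Q`.
-/

open Polynomial

namespace Literature.Algebra.Polynomial.StengleDegreeZeroThreshold

/-- **Necessity at degree 0.**  If `1 − x² + δ = P (1 − x²)³ + Q` with `Q ≥ 0` on `ℝ` and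
`P` constant (`deg P = 0`; the sign of `P` is not even needed), then `δ ≥ 1/3` — evaluate at
`x = 0` and at `x = √(3/2)`.
[cite: BlekhermanParriloThomas2012, Ch. 3 Exercise 3.140 (2) (p. 121), case N = 0] -/
theorem one_third_le_of_natDegree_eq_zero {δ : ℝ} {P Q : ℝ[X]}
    (hQ : ∀ x : ℝ, 0 ≤ Q.eval x) (h : (1 - X ^ 2 + C δ : ℝ[X]) = P * (1 - X ^ 2) ^ 3 + Q)
    (hdeg : P.natDegree = 0) : 1 / 3 ≤ δ := by
  -- `P` is the constant `p = P(0)`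
  have hPC : P = C (P.eval 0) := by
    rw [eq_C_of_natDegree_eq_zero hdeg]
    simp
  set p : ℝ := P.eval 0 with hp
  have hid : ∀ x : ℝ, 1 - x ^ 2 + δ = p * (1 - x ^ 2) ^ 3 + Q.eval x := by
    intro x
    have hx := congrArg (eval x) h
    rw [hPC] at hx
    simpa [eval_add, eval_sub, eval_mul, eval_pow, eval_X, eval_C, eval_one] using hx
  -- at `x = 0`: `p ≤ 1 + δ`
  have h0 := hid 0
  have hQ0 := hQ 0
  -- at `x = √(3/2)`: `(1 − x²)³ = −1/8`
  set x₀ : ℝ := Real.sqrt (3 / 2) with hx₀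
  have hx₀sq : x₀ ^ 2 = 3 / 2 := by
    rw [hx₀, Real.sq_sqrt (by norm_num)]
  have h1 := hid x₀
  have hQ1 := hQ x₀
  rw [hx₀sq] at h1
  nlinarith

/-- **The first rung is exactly optimal: `N(δ) = 0 ⟺ δ ≥ 1/3`.**  A representation
`1 − x² + δ = P (1 − x²)³ + Q` with `P, Q ≥ 0` on `ℝ` and `deg P = 0` exists iff `δ ≥ 1/3`
(sufficiency: the `N = 2` Chebyshev certificate `4/3 − x² = (4/3)(1 − x²)³ + (1/3)x²(3 − 2x²)²`,
`StengleDegreeUpperBound.exists_certificate_of_le`).  This is the case `N = 0` of BPT's "optimal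
`γ*_N`"; Stengle's printed degree-0 example sits at `δ = 2/3 ≥ 1/3`.
[cite: BlekhermanParriloThomas2012, Ch. 3 Exercise 3.140 (2) (p. 121); Stengle1996, (1) and Example (p. 169)] -/
theorem exists_natDegree_eq_zero_iff (δ : ℝ) :
    (∃ P Q : ℝ[X], (∀ x : ℝ, 0 ≤ P.eval x) ∧ (∀ x : ℝ, 0 ≤ Q.eval x) ∧ P.natDegree = 0 ∧
      (1 - X ^ 2 + C δ : ℝ[X]) = P * (1 - X ^ 2) ^ 3 + Q) ↔ 1 / 3 ≤ δ := by
  constructor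
  · rintro ⟨P, Q, -, hQ, hdeg, h⟩
    exact one_third_le_of_natDegree_eq_zero hQ h hdeg
  · intro hδ
    have hδ' : 1 / ((2 : ℕ) ^ 2 - 1 : ℝ) ≤ δ := by norm_num; linarith
    obtain ⟨P, Q, hP, hQ, hdeg, h⟩ :=
      StengleDegreeUpperBound.exists_certificate_of_le (N := 2) le_rfl (by exact_mod_cast hδ')
    exact ⟨P, Q, hP, hQ, by omega, h⟩

/-- Equivalently, in the lower-bound direction used by `N(δ)`: for `δ < 1/3` every representation
(1) (with `Q ≥ 0` on `ℝ`) has `deg P ≥ 1`. [cite: BlekhermanParriloThomas2012, Ch. 3 Exercise 3.140 (2) (p. 121), case N = 0] -/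
theorem one_le_natDegree_of_lt_one_third {δ : ℝ} (hδ : δ < 1 / 3) {P Q : ℝ[X]}
    (hQ : ∀ x : ℝ, 0 ≤ Q.eval x)
    (h : (1 - X ^ 2 + C δ : ℝ[X]) = P * (1 - X ^ 2) ^ 3 + Q) : 1 ≤ P.natDegree := by
  by_contra hlt
  have hdeg : P.natDegree = 0 := by omega
  exact absurd (one_third_le_of_natDegree_eq_zero hQ h hdeg) (not_le.2 hδ)

end Literature.Algebra.Polynomial.StengleDegreeZeroThreshold
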